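/-
Copyright (c) 2026 the pub-hodgecm-mathlib formalisation cell (harness21).  Prover seat hodgecm-mathlib-K2E4-p11 (g4), Track B ∕ K2-LIT, h413 =
`stmt-HodgeConjecture-24833`, line `K2_E1_TraceFormulaBeta`, campaign «EIS-RANK-ONE», rung R6d₃, deal (D2-f) of K2E1-plan (g4) 2026-09-04T06:42:41Z («=» 06:50:04Z),
FILE 2∕2: THE `x₀`-SHELL SUM of the centre-line mass over the dilated shifted lattice `l₁(E − Y)` — the `hshell` binder of the (D2-e) assembly.
-/
import Summits.HodgeConjecture.HodgeConjecture.Theorems.K2E1CentreLineMassU3               -- FILE 1∕2 (this seat): Eisenstein domination at every point, the `N(F)`-shell, the centre-line mass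
import Summits.HodgeConjecture.HodgeConjecture.Theorems.K2E1BigCellHeisenbergDilationU3     -- ★ p857768 (K2E3-p14 (g4)): torus conjugation in the chart, the central scalar `Λ₂` and its norm
import Summits.HodgeConjecture.HodgeConjecture.Theorems.K2E1IntertwiningGrowthU3            -- ★ p857898 (K2E4-p14 (g5)): `borelHeight_weylLongU_mul_diag_mul` (`H(w₀ t x) = ‖d₀‖⁻¹ H(w₀ x)`)
import Summits.HodgeConjecture.HodgeConjecture.Theorems.K2E1BorelHeightWeylUnipotent         -- ★ p857… (K2E1-p09 (g4)): the adelic big cell `H(w₀ n g) ≤ H(g)⁻¹`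
import HarnessLib

/-!
# h413 ∕ Track B «K2-LIT», «EIS-RANK-ONE» R6d₃ (D2-f) FILE 2∕2 — `K2E1CentreLineShellSumU3`: the shell sum
# `Σ_{x₀ ∈ E} ∫_{𝔸_F} H(ι(w₀)·u(l₁(x₀ − Y), θ t))^σ dμ_F(t) ≤ B · |l₁|^{1 − 2σ′}` (`2 < σ′ ≤ σ`, `|l₁| ≤ 1`)

Cell `pub/hodgecm-mathlib`, crux H413 = `stmt-HodgeConjecture-24833`, route `HCCMUnconditional`; dealer K2E1-plan (g4), deal (D2-f) 2026-09-04T06:42:41Z, REPORT-FIRST 06:49:46Z, «=»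
06:50:04Z (interface of record: the `k`-free centre-line mass over the full centre line `𝔸_F`, exponent `θ = 2σ′ − 1`).  THEOREMS ONLY (no `def`, no `instance`, no `notation`, no
named-fact hypothesis, no `sorry`); lane `--kind proof --supports stmt-HodgeConjecture-24833 --as helper` (count-neutral).  Letters: `u = heisChart hc`, `θ = traceZeroLine F E c hcδ hδ`,
`ι(w₀)`, `H = borelHeight`, `D_F = adeleFundamentalDomain F`, `‖·‖ = IdeleClassGroup.ideleNorm`.
THE COMPUTATION (generic quadratic `(F, E, c)`, `c² = 1 ≠ c`, Iwasawa `hIw`).  Fix `l₁ ∈ 𝕀_E`, `Y ∈ 𝔸_E`, `L = ‖l₁‖_E ≤ 1`, and let `t₀ = diag(l₁⁻¹, 1, c(l₁)) ∈ T(𝔸_F)` (★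
`exists_torus_diagUnit_eq`) with central scalar `Λ₂` (`(Λ₂)_E = d₀⁻¹d₂`, ★ `exists_centralScalar_three`; `‖Λ₂‖_F = ‖d₀‖⁻¹ = L` ★ `ideleNorm_centralScalar_three`).
* §1 plumbing on `𝔸_K`: Tate's `d(Λ x) = ‖Λ‖ dx` for `∫⁻` (`lintegral_eq_ideleNorm_mul_lintegral_comp_mul`, ★ `AdeleRing.addHaar_smul_eq_ideleNorm_mul`).
* §2 UNDOING THE DILATION: `ι(w₀)·u((d₀⁻¹d₁)X′, θ(Λ₂ s)) = ι(w₀)·t₀⁻¹·u(X′, θ s)·t₀` (★ `torus_inv_mul_heisChart_traceZeroLine_mul_torus`) hence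
  **`borelHeight_weylLongU_heisChart_dilate_three`**: `H(ι(w₀)·u((d₀⁻¹d₁)X′, θ(Λ₂ s))·k) = ‖d₀‖ · H(ι(w₀)·u(X′, θ s)·(t₀·k))` (★ `borelHeight_weylLongU_mul_diag_mul`); for our `t₀`,
  `d₀⁻¹d₁ = l₁` and `‖d₀‖ = L⁻¹`.
* §3 THE HEAD **`exists_forall_tsum_lineMass_dilate_sub_le_three`**: with `N(X) = ∫_{𝔸_F} H(ι(w₀)·u(X, θ t))^σ dμ_F(t)` (FILE 1), for `2 < σ′ ≤ σ` ONE `B ≥ 0` (`= μ_F(D_F)·A₁(σ′)`) with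
  `Summable (x₀ ↦ N(l₁(x₀ − Y)))` and `Σ'_{x₀} N(l₁(x₀ − Y)) ≤ B · (‖l₂‖⁻¹)^{2σ′−1}` whenever `‖l₂‖_F ≤ 1`, `‖l₁‖_E = ‖l₂‖_F` — the `hshell` binder of the (D2-e) assembly with
  `N₂F k X ↦ N X`, `θ ↦ 2σ′ − 1` (the consumer's `hθ : θ + 1 ≤ Re z + m∕[F:ℚ]` reads `2σ′ ≤ Re z + m∕[F:ℚ]`, satisfiable since `m > [E:ℚ]`).  Chain (all in `ℝ≥0∞`):
  substitute `t = Λ₂ s` (§1, Jacobian `L`) and undo the dilation (§2, factor `L^{−σ}`): `N(l₁X′) = L^{1−σ} ∫ H(ι(w₀)·u(X′, θ s)·t₀)^σ ds`; shift `u(x₀ − Y, θ s) = u(x₀, θ(s − β))·u(−Y, θ 0)`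
  (★ `heisChart_traceZeroLine_mul`, translation invariance); unfold `𝔸_F = ⨆_ξ (ξ + D_F)` and split `u(x₀, θ(ξ + a)) = u(x₀, θ ξ)·u(0, θ a)` (★ `heisChart_mul_zero`): the double
  sum `Σ_{(x₀, ξ) ∈ E × F}` is the `N(F)`-shell of FILE 1 §2 at the base point `y_a = u(0, θ a)·u(−Y, θ 0)·t₀` of height `L⁻¹ ≥ 1`; trade `σ − σ′` powers through the adelic big cell
  `H(ι(w₀) n y_a) ≤ H(y_a)⁻¹ = L` (★) and dominate the rest by `A₁·max(H y_a, H y_a⁻¹)^{σ′} = A₁ L^{−σ′}`: total `L^{1−σ}·μ(D_F)·L^{σ−σ′}·A₁·L^{−σ′} = B·L^{1−2σ′}`.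
  WHY NOT `θ = σ`: the domination bound at height `L⁻¹` is carried by the identity coset (`H^{σ′}`), which only the constant-term asymptotics (the (D2) campaign itself) could remove;
  lattice counting would give `≍ L^{−1}` but needs a height-zeta sum with non-compact finite support (not ★ (E2)).  Recorded on the K2 bus 06:49:46Z ∕ 06:50:04Z.
HONEST LABEL.  Count-neutral helper; proves no printed statement; HC_CM is proved only modulo the 7 printed citations (2 remaining named inputs: hLiu418 =
`stmt-HodgeConjecture-24832`, h413 = `stmt-HodgeConjecture-24833`) until rung 0 closes.

## References
* [MoeglinWaldspurger1995] C. Mœglin, J.-L. Waldspurger, *Spectral decomposition and Eisenstein series* (1995), I.2.13, II.1.5, II.1.7.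
* [Garrett2018] P. Garrett, *Modern Analysis of Automorphic Forms by Example* 1 (2018), §2.3, §2.8–§2.9, §3.10–§3.11.
* [Rogawski1990] J. D. Rogawski, *Automorphic Representations of Unitary Groups in Three Variables* (1990), §1.10, §2.2.
* [CasselsFrohlichANT1967] J. Tate, *Fourier analysis in number fields and Hecke's zeta-functions*, in Cassels–Fröhlich (1967), Ch. XV Lemma 4.1.2, Thm. 4.1.3.
-/

set_option autoImplicit false
set_option linter.dupNamespace false  -- the mandated namespace repeats the summit's segment (`HodgeConjecture.HodgeConjecture`)

noncomputable section

open MeasureTheory Measure Filter Topology NumberField IsDedekindDomain MulAction Set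
open Literature.NumberTheory.Automorphic Literature.NumberTheory.Automorphic.UnitaryGroup
open Summit.HodgeConjecture.HodgeConjecture.Cruxes.H413.K2E1BorelEisensteinU
open Summit.HodgeConjecture.HodgeConjecture.Cruxes.H413.K2E1FlatSectionLineRestrictionU3
open Summit.HodgeConjecture.HodgeConjecture.Cruxes.H413.K2E1BigCellHeisenbergDilationU3
open Summit.HodgeConjecture.HodgeConjecture.Cruxes.H413.K2E1IntertwiningGrowthU3
open Summit.HodgeConjecture.HodgeConjecture.Cruxes.H413.K2E1BorelHeightWeylUnipotent
open Summit.HodgeConjecture.HodgeConjecture.Cruxes.H413.K2E1CentreLineMassU3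
open scoped ENNReal NNReal Pointwise

namespace Summit.HodgeConjecture.HodgeConjecture.Cruxes.H413.K2E1CentreLineShellSumU3

/-! ## §1 Plumbing: `∫⁻ g dμ = ‖a‖ · ∫⁻ g(a x) dμ(x)` on `𝔸_K` -/

section Module

/-- **TATE'S MODULE FOR `∫⁻`**: `∫⁻ g dμ = ‖a‖_𝔸 · ∫⁻ g(a·x) dμ(x)` for an idele `a`, an additive Haar measure `μ` on `𝔸_K` and a measurable `g ≥ 0` (`d(a x) = ‖a‖ dx`, ★
`AdeleRing.addHaar_smul_eq_ideleNorm_mul`). [cite: CasselsFrohlichANT1967, Ch. XV Lemma 4.1.2] -/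
theorem lintegral_eq_ideleNorm_mul_lintegral_comp_mul (K : Type) [Field K] [NumberField K] [MeasurableSpace (AdeleRing (𝓞 K) K)] [BorelSpace (AdeleRing (𝓞 K) K)]
    (μ : Measure (AdeleRing (𝓞 K) K)) [μ.IsAddHaarMeasure] (a : (AdeleRing (𝓞 K) K)ˣ) {g : AdeleRing (𝓞 K) K → ℝ≥0∞} (hg : Measurable g) :
    ∫⁻ x, g x ∂μ = (IdeleClassGroup.ideleNorm K a : ℝ≥0∞) * ∫⁻ x, g ((a : AdeleRing (𝓞 K) K) * x) ∂μ := by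
  haveI : LocallyCompactSpace (AdeleRing (𝓞 K) K) := locallyCompactSpace_adeleRing' K
  haveI : SecondCountableTopology (AdeleRing (𝓞 K) K) := secondCountableTopology_adeleRing K
  haveI : μ.Regular := by infer_instance
  have hmeas : Measurable fun x : AdeleRing (𝓞 K) K => (a : AdeleRing (𝓞 K) K) * x := measurable_const_mul _
  have hmap : μ.map (fun x : AdeleRing (𝓞 K) K => (a : AdeleRing (𝓞 K) K) * x) = ((IdeleClassGroup.ideleNorm K a : ℝ≥0∞)⁻¹) • μ := by
    ext s hs
    rw [Measure.map_apply hmeas hs, Measure.smul_apply, smul_eq_mul]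
    have hpre : (fun x : AdeleRing (𝓞 K) K => (a : AdeleRing (𝓞 K) K) * x) ⁻¹' s = (a⁻¹ : (AdeleRing (𝓞 K) K)ˣ) • s := by
      ext x
      rw [Set.mem_preimage, Set.mem_smul_set_iff_inv_smul_mem, inv_inv, Units.smul_def, smul_eq_mul]
    rw [hpre, AdeleRing.addHaar_smul_eq_ideleNorm_mul K μ a⁻¹ s, map_inv, ENNReal.coe_inv (ideleNorm_ne_zero a)]
  have h0 : (IdeleClassGroup.ideleNorm K a : ℝ≥0∞) ≠ 0 := ENNReal.coe_ne_zero.2 (ideleNorm_ne_zero a)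
  rw [← lintegral_map hg hmeas, hmap, lintegral_smul_measure, smul_eq_mul, ← mul_assoc, ENNReal.mul_inv_cancel h0 ENNReal.coe_ne_top, one_mul]

end Module

/-! ## §2 Undoing the dilation on the Heisenberg group of `U(J₃)` -/

section Heisenberg

variable {F E : Type} [Field F] [NumberField F] [Field E] [NumberField E] [Algebra F E] [Algebra.IsQuadraticExtension F E] {c : E ≃ₐ[F] E}
  {δ : E}

/-- **UNDOING THE DILATION**: for `t ∈ T(𝔸_F)` with diagonal `(d₀, d₁, d₂)` and central scalar `Λ₂` (`(Λ₂)_E = d₀⁻¹d₂`), every `X′ ∈ 𝔸_E`, `s ∈ 𝔸_F`, `k ∈ G(𝔸_F)`: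
`H(ι(w₀)·u((d₀⁻¹d₁)X′, θ(Λ₂ s))·k) = ‖d₀‖_E · H(ι(w₀)·u(X′, θ s)·(t·k))` — `u((d₀⁻¹d₁)X′, θ(Λ₂ s)) = t⁻¹·u(X′, θ s)·t` (★ p857768 §3) and `H(ι(w₀)·t⁻¹·x) = ‖d₀(t⁻¹)‖⁻¹·H(ι(w₀)·x)` (★
`borelHeight_weylLongU_mul_diag_mul`). [cite: Rogawski1990, §1.10] [cite: Garrett2018, §2.2, §2.9] -/
theorem borelHeight_weylLongU_heisChart_dilate_three (hc : c * c = 1) (hcδ : c δ = -δ) (hδ : δ ≠ 0) (t : ↥(torusInBorel F E c 3)) (Λ₂ : (AdeleRing (𝓞 F) F)ˣ)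
    (hΛ₂ : ((AdeleRing.ideleBaseChange F E Λ₂ : (AdeleRing (𝓞 E) E)ˣ) : AdeleRing (𝓞 E) E) =
      (((diagUnit (t : borelAdelic F E c 3).2 0)⁻¹ * diagUnit (t : borelAdelic F E c 3).2 2 : (AdeleRing (𝓞 E) E)ˣ) : AdeleRing (𝓞 E) E))
    (X : AdeleRing (𝓞 E) E) (s : AdeleRing (𝓞 F) F) (k : (quasiSplit F E c 3).Adelic) :
    borelHeight ((quasiSplit F E c 3).toAdelic (weylLongU (c : E →+* E) (rfl : ((StdForm.antidiagonal 3).over E) = ((StdForm.antidiagonal 3).over E))) *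
        ((heisChart hc ((((diagUnit (t : borelAdelic F E c 3).2 0)⁻¹ * diagUnit (t : borelAdelic F E c 3).2 1 : (AdeleRing (𝓞 E) E)ˣ) : AdeleRing (𝓞 E) E) * X,
          traceZeroLine F E c hcδ hδ ((Λ₂ : AdeleRing (𝓞 F) F) * s)) : ↥(adelicUnipotent F E c 3)) : (quasiSplit F E c 3).Adelic) * k) =
      IdeleClassGroup.ideleNorm E (diagUnit (t : borelAdelic F E c 3).2 0) *
        borelHeight ((quasiSplit F E c 3).toAdelic (weylLongU (c : E →+* E) (rfl : ((StdForm.antidiagonal 3).over E) = ((StdForm.antidiagonal 3).over E))) *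
          ((heisChart hc (X, traceZeroLine F E c hcδ hδ s) : ↥(adelicUnipotent F E c 3)) : (quasiSplit F E c 3).Adelic) * (((t : borelAdelic F E c 3) : (quasiSplit F E c 3).Adelic) * k)) := by
  rw [← torus_inv_mul_heisChart_traceZeroLine_mul_torus hc hcδ hδ t Λ₂ hΛ₂ X s]
  have hti : (((t : borelAdelic F E c 3) : (quasiSplit F E c 3).Adelic))⁻¹ = (((t⁻¹ : ↥(torusInBorel F E c 3)) : borelAdelic F E c 3) : (quasiSplit F E c 3).Adelic) := rfl
  simp only [mul_assoc]
  rw [hti, borelHeight_weylLongU_mul_diag_mul (glDiagonal_diagUnit_torus_inv t), Pi.inv_apply, map_inv, inv_inv]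

/-- The integrand `t ↦ H(ι(w₀)·u(X, θ t))^σ` of the `k`-free centre-line mass is continuous (`σ ≥ 0`). [cite: Rogawski1990, §1.10] -/
theorem continuous_centreLine_borelHeight_rpow_three' (hc : c * c = 1) (hcδ : c δ = -δ) (hδ : δ ≠ 0) {σ : ℝ} (hσ : 0 ≤ σ) (X : AdeleRing (𝓞 E) E) :
    Continuous fun t : AdeleRing (𝓞 F) F => ((borelHeight ((quasiSplit F E c 3).toAdelic (weylLongU (c : E →+* E) (rfl : ((StdForm.antidiagonal 3).over E) = ((StdForm.antidiagonal 3).over E))) *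
        ((heisChart hc (X, traceZeroLine F E c hcδ hδ t) : ↥(adelicUnipotent F E c 3)) : (quasiSplit F E c 3).Adelic)) : ℝ)) ^ σ :=
  ((NNReal.continuous_coe.comp continuous_borelHeight).comp (continuous_const.mul (continuous_coe_heisChart_traceZeroLine hc hcδ hδ X))).rpow_const fun _ => Or.inr hσ

/-- Real bookkeeping: `L · (L⁻¹)^σ · L^{σ−σ′} · (L⁻¹)^{σ′} = (L⁻¹)^{2σ′−1}` for `L > 0`. [folklore] -/
theorem mul_inv_rpow_mul_rpow_sub_mul_inv_rpow {L : ℝ} (hL : 0 < L) (σ σ' : ℝ) :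
    L * L⁻¹ ^ σ * L ^ (σ - σ') * L⁻¹ ^ σ' = L⁻¹ ^ (2 * σ' - 1) := by
  calc L * L⁻¹ ^ σ * L ^ (σ - σ') * L⁻¹ ^ σ' = L ^ (1 : ℝ) * L ^ (-σ) * L ^ (σ - σ') * L ^ (-σ') := by
        rw [Real.rpow_one, Real.inv_rpow hL.le, Real.inv_rpow hL.le, Real.rpow_neg hL.le, Real.rpow_neg hL.le]
    _ = L ^ ((1 : ℝ) + -σ + (σ - σ') + -σ') := by rw [Real.rpow_add hL, Real.rpow_add hL, Real.rpow_add hL]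
    _ = L⁻¹ ^ (2 * σ' - 1) := by
        rw [Real.inv_rpow hL.le, ← Real.rpow_neg hL.le]
        congr 1
        ring

/-! ## §3 The head: the shell sum of the centre-line mass over `l₁(E − Y)` -/

/-- **(D2-f) THE `x₀`-SHELL SUM OF THE CENTRE-LINE MASS (the `hshell` binder of the (D2-e) assembly `K2E1EisensteinMinusConstantTermBoundedCMThree`).**  `[E:F] = 2`, `c² = 1 ≠ c`,
Iwasawa `hIw`, an additive Haar measure `μ_F` on `𝔸_F`, `2 < σ′ ≤ σ`.  With `N(X) := ∫_{𝔸_F} H(ι(w₀)·u(X, θ t))^σ dμ_F(t)` (finite for every `X`, FILE 1 §3) there is ONE `B ≥ 0` such that for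
all `l₁ ∈ 𝕀_E`, `l₂ ∈ 𝕀_F`, `Y ∈ 𝔸_E` with `‖l₂‖_F ≤ 1`, `‖l₁‖_E = ‖l₂‖_F`:
`Summable (x₀ ↦ N(l₁·((x₀)_𝔸 − Y)))` and `Σ'_{x₀ ∈ E} N(l₁·((x₀)_𝔸 − Y)) ≤ B · (‖l₂‖⁻¹)^{2σ′ − 1}`.
See the module docstring for the chain (Tate's module, undoing the dilation by `t₀ = diag(l₁⁻¹, 1, c l₁)`, the Heisenberg shift, unfolding `𝔸_F∕F`, FILE 1's `N(F)`-shell domination at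
height `L⁻¹`, the adelic big cell for the `σ − σ′` excess). [cite: MoeglinWaldspurger1995, II.1.7] [cite: Garrett2018, §2.8–§2.9] [cite: Rogawski1990, §1.10] [cite: CasselsFrohlichANT1967, Ch. XV Lemma 4.1.2] -/
theorem exists_forall_tsum_lineMass_dilate_sub_le_three (hc : c * c = 1) (hc1 : c ≠ 1) (hcδ : c δ = -δ) (hδ : δ ≠ 0)
    (hIw : ∀ g : (quasiSplit F E c 3).Adelic, ∃ b ∈ borelAdelic F E c 3, ∃ k : (quasiSplit F E c 3).Adelic,
      adelicVal F E c 3 ((StdForm.antidiagonal 3).over E) k ∈ standardMaximalCompactGL 3 E ∧ g = b * k)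
    [MeasurableSpace (AdeleRing (𝓞 F) F)] [BorelSpace (AdeleRing (𝓞 F) F)] (μF : Measure (AdeleRing (𝓞 F) F)) [μF.IsAddHaarMeasure]
    {σ σ' : ℝ} (hσ' : 2 < σ') (hσ'σ : σ' ≤ σ) :
    ∃ B : ℝ, 0 ≤ B ∧ ∀ (l₁ : (AdeleRing (𝓞 E) E)ˣ) (l₂ : (AdeleRing (𝓞 F) F)ˣ) (Y : AdeleRing (𝓞 E) E),
      ((IdeleClassGroup.ideleNorm F l₂ : ℝ≥0) : ℝ) ≤ 1 →
      ((IdeleClassGroup.ideleNorm E l₁ : ℝ≥0) : ℝ) = ((IdeleClassGroup.ideleNorm F l₂ : ℝ≥0) : ℝ) →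
      Summable (fun x₀ : E => ∫ t, ((borelHeight ((quasiSplit F E c 3).toAdelic (weylLongU (c : E →+* E) (rfl : ((StdForm.antidiagonal 3).over E) = ((StdForm.antidiagonal 3).over E))) *
          ((heisChart hc ((l₁ : AdeleRing (𝓞 E) E) * (algebraMap E (AdeleRing (𝓞 E) E) x₀ - Y), traceZeroLine F E c hcδ hδ t) : ↥(adelicUnipotent F E c 3)) :
            (quasiSplit F E c 3).Adelic)) : ℝ)) ^ σ ∂μF) ∧
      ∑' x₀ : E, ∫ t, ((borelHeight ((quasiSplit F E c 3).toAdelic (weylLongU (c : E →+* E) (rfl : ((StdForm.antidiagonal 3).over E) = ((StdForm.antidiagonal 3).over E))) *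
          ((heisChart hc ((l₁ : AdeleRing (𝓞 E) E) * (algebraMap E (AdeleRing (𝓞 E) E) x₀ - Y), traceZeroLine F E c hcδ hδ t) : ↥(adelicUnipotent F E c 3)) :
            (quasiSplit F E c 3).Adelic)) : ℝ)) ^ σ ∂μF ≤
        B * (((IdeleClassGroup.ideleNorm F l₂ : ℝ≥0) : ℝ)⁻¹) ^ (2 * σ' - 1) := by
  classical
  haveI : Countable E := NumberField.countable' (K := E)
  haveI : Countable F := NumberField.countable' (K := F)
  have hσ0 : (0 : ℝ) ≤ σ := by linarith
  have hσ'0 : (0 : ℝ) ≤ σ' := by linarith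
  obtain ⟨A₁, hA₁, hshell⟩ := exists_forall_tsum_prod_borelHeight_heisChart_rpow_le_three hc hc1 hcδ hδ hIw hσ'
  refine ⟨(μF (adeleFundamentalDomain F)).toReal * A₁, mul_nonneg ENNReal.toReal_nonneg hA₁, fun l₁ l₂ Y hl₂ hl₁₂ => ?_⟩
  set W : (quasiSplit F E c 3).Adelic :=
    (quasiSplit F E c 3).toAdelic (weylLongU (c : E →+* E) (rfl : ((StdForm.antidiagonal 3).over E) = ((StdForm.antidiagonal 3).over E))) with hW
  -- the scalar `L = ‖l₁‖_E = ‖l₂‖_F ∈ (0, 1]`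
  set L : ℝ≥0 := IdeleClassGroup.ideleNorm F l₂ with hL
  have hLE : IdeleClassGroup.ideleNorm E l₁ = L := NNReal.coe_injective hl₁₂
  have hL0 : L ≠ 0 := ideleNorm_ne_zero l₂
  have hLpos : (0 : ℝ) < L := NNReal.coe_pos.2 (pos_iff_ne_zero.2 hL0)
  have hL1 : L ≤ 1 := NNReal.coe_le_coe.1 (by simpa using hl₂)
  have hmax : max L⁻¹ L⁻¹⁻¹ = L⁻¹ := max_eq_left (by rw [inv_inv]; exact hL1.trans (one_le_inv_iff₀.2 ⟨pos_iff_ne_zero.2 hL0, hL1⟩))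
  -- the torus element `t₀ = diag(l₁⁻¹, 1, c l₁)` and its central scalar
  obtain ⟨t, -, ht0, ht1⟩ := exists_torus_diagUnit_eq hc l₁⁻¹ 1 (by rw [Units.val_one, map_one, mul_one])
  obtain ⟨Λ₂, hΛ₂⟩ := exists_centralScalar_three hcδ hδ t
  have hΛnorm : IdeleClassGroup.ideleNorm F Λ₂ = L := by rw [ideleNorm_centralScalar_three t Λ₂ hΛ₂, ht0, map_inv, inv_inv, hLE]
  have hlam : (diagUnit (t : borelAdelic F E c 3).2 0)⁻¹ * diagUnit (t : borelAdelic F E c 3).2 1 = l₁ := by rw [ht0, ht1, inv_inv, mul_one]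
  have hd0 : IdeleClassGroup.ideleNorm E (diagUnit (t : borelAdelic F E c 3).2 0) = L⁻¹ := by rw [ht0, map_inv, hLE]
  set T : (quasiSplit F E c 3).Adelic := ((t : borelAdelic F E c 3) : (quasiSplit F E c 3).Adelic) with hT
  have hHT : borelHeight T = L⁻¹ := by
    rw [hT, ← mul_one (((t : borelAdelic F E c 3) : (quasiSplit F E c 3).Adelic)), borelHeight_torus_coe_mul t 1, K2E1HeightFunctionU3.borelHeight_one, mul_one, hd0]
  -- the base points `y_a = u(0, θ a)·(u(−Y, θ 0)·t₀)`, all of height `L⁻¹`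
  set y : AdeleRing (𝓞 F) F → (quasiSplit F E c 3).Adelic := fun a =>
    ((heisChart hc ((0 : AdeleRing (𝓞 E) E), traceZeroLine F E c hcδ hδ a) : ↥(adelicUnipotent F E c 3)) : (quasiSplit F E c 3).Adelic) *
      (((heisChart hc (-Y, traceZeroLine F E c hcδ hδ 0) : ↥(adelicUnipotent F E c 3)) : (quasiSplit F E c 3).Adelic) * T) with hy
  have hHy : ∀ a, borelHeight (y a) = L⁻¹ := fun a => by
    rw [hy]
    dsimp only
    rw [borelHeight_unipotent_mul (heisChart hc ((0 : AdeleRing (𝓞 E) E), traceZeroLine F E c hcδ hδ a)).2,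
      borelHeight_unipotent_mul (heisChart hc (-Y, traceZeroLine F E c hcδ hδ 0)).2, hHT]
  -- the shell terms at exponent `σ` and `σ'`
  set G : ℝ → E × F → AdeleRing (𝓞 F) F → ℝ≥0∞ := fun τ p a => ENNReal.ofReal (((borelHeight (W *
      ((heisChart hc (algebraMap E (AdeleRing (𝓞 E) E) p.1, traceZeroLine F E c hcδ hδ (algebraMap F (AdeleRing (𝓞 F) F) p.2)) : ↥(adelicUnipotent F E c 3)) : (quasiSplit F E c 3).Adelic) *
      y a) : ℝ)) ^ τ) with hG
  have hGm : ∀ p, Measurable (G σ p) := fun p => by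
    simp only [hG, hy]
    exact measurable_ofReal_borelHeight_mul_heisChart_line_rpow hc hcδ hδ hσ0 _ _ (0 : AdeleRing (𝓞 E) E)
  -- (e) the pointwise domination of the shell at the base point `y a`
  have hdom : ∀ a, ∑' p : E × F, G σ p a ≤ ENNReal.ofReal ((L : ℝ) ^ (σ - σ')) * ENNReal.ofReal (A₁ * ((L : ℝ)⁻¹) ^ σ') := by
    intro a
    have hy0 : borelHeight (y a) ≠ 0 := (borelHeight_pos (y a)).ne'
    have hterm : ∀ p : E × F, G σ p a ≤ ENNReal.ofReal ((L : ℝ) ^ (σ - σ')) * G σ' p a := by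
      intro p
      simp only [hG]
      set h : ℝ := ((borelHeight (W * ((heisChart hc (algebraMap E (AdeleRing (𝓞 E) E) p.1, traceZeroLine F E c hcδ hδ (algebraMap F (AdeleRing (𝓞 F) F) p.2)) :
        ↥(adelicUnipotent F E c 3)) : (quasiSplit F E c 3).Adelic) * y a) : ℝ)) with hh
      have hh0 : 0 ≤ h := NNReal.coe_nonneg _
      have hhL : h ≤ L := by
        have h1 := borelHeight_weylLongU_unipotent_mul_le_inv (heisChart hc (algebraMap E (AdeleRing (𝓞 E) E) p.1, traceZeroLine F E c hcδ hδ (algebraMap F (AdeleRing (𝓞 F) F) p.2))).2 hy0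
        rw [hHy a, inv_inv] at h1
        exact_mod_cast h1
      rw [← ENNReal.ofReal_mul (Real.rpow_nonneg hLpos.le _)]
      refine ENNReal.ofReal_le_ofReal ?_
      calc h ^ σ = h ^ (σ - σ') * h ^ σ' := by rw [← Real.rpow_add' hh0 (by linarith : σ - σ' + σ' ≠ 0), sub_add_cancel]
        _ ≤ (L : ℝ) ^ (σ - σ') * h ^ σ' := mul_le_mul_of_nonneg_right (Real.rpow_le_rpow hh0 hhL (by linarith)) (Real.rpow_nonneg hh0 _)
    calc ∑' p : E × F, G σ p a ≤ ∑' p : E × F, ENNReal.ofReal ((L : ℝ) ^ (σ - σ')) * G σ' p a := ENNReal.tsum_le_tsum hterm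
      _ = ENNReal.ofReal ((L : ℝ) ^ (σ - σ')) * ∑' p : E × F, G σ' p a := ENNReal.tsum_mul_left
      _ ≤ ENNReal.ofReal ((L : ℝ) ^ (σ - σ')) * ENNReal.ofReal (A₁ * ((L : ℝ)⁻¹) ^ σ') := by
          refine mul_le_mul_of_nonneg_left ?_ zero_le
          have h' := hshell (y a)
          rw [hHy a, hmax, NNReal.coe_inv] at h'
          exact h'
  -- (a)–(c) the per-`x₀` identity: `N(l₁(x₀ − Y)) = L · ofReal((L⁻¹)^σ) · Σ_ξ ∫⁻_{D_F} G σ (x₀, ξ) a da`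
  have h𝓓 := isAddFundamentalDomain_adeleFundamentalDomain F μF
  have hper : ∀ x₀ : E, ∫⁻ s, ENNReal.ofReal (((borelHeight (W * ((heisChart hc ((l₁ : AdeleRing (𝓞 E) E) * (algebraMap E (AdeleRing (𝓞 E) E) x₀ - Y), traceZeroLine F E c hcδ hδ s) :
      ↥(adelicUnipotent F E c 3)) : (quasiSplit F E c 3).Adelic)) : ℝ)) ^ σ) ∂μF =
        (L : ℝ≥0∞) * (ENNReal.ofReal (((L : ℝ)⁻¹) ^ σ) * ∑' ξ : F, ∫⁻ a in adeleFundamentalDomain F, G σ (x₀, ξ) a ∂μF) := by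
    intro x₀
    set X' : AdeleRing (𝓞 E) E := algebraMap E (AdeleRing (𝓞 E) E) x₀ - Y with hX'
    -- (a) Tate's module `t = Λ₂ s` and the dilation
    have hmeasΦ : Measurable fun s : AdeleRing (𝓞 F) F => ENNReal.ofReal (((borelHeight (W * ((heisChart hc ((l₁ : AdeleRing (𝓞 E) E) * X', traceZeroLine F E c hcδ hδ s) :
        ↥(adelicUnipotent F E c 3)) : (quasiSplit F E c 3).Adelic)) : ℝ)) ^ σ) :=
      ENNReal.measurable_ofReal.comp (continuous_centreLine_borelHeight_rpow_three' hc hcδ hδ hσ0 _).measurable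
    rw [lintegral_eq_ideleNorm_mul_lintegral_comp_mul F μF Λ₂ hmeasΦ, hΛnorm]
    congr 1
    have hdil : ∀ s : AdeleRing (𝓞 F) F, ENNReal.ofReal (((borelHeight (W * ((heisChart hc ((l₁ : AdeleRing (𝓞 E) E) * X', traceZeroLine F E c hcδ hδ ((Λ₂ : AdeleRing (𝓞 F) F) * s)) :
        ↥(adelicUnipotent F E c 3)) : (quasiSplit F E c 3).Adelic)) : ℝ)) ^ σ) =
        ENNReal.ofReal (((L : ℝ)⁻¹) ^ σ) * ENNReal.ofReal (((borelHeight (W * ((heisChart hc (X', traceZeroLine F E c hcδ hδ s) : ↥(adelicUnipotent F E c 3)) :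
          (quasiSplit F E c 3).Adelic) * T) : ℝ)) ^ σ) := by
      intro s
      have h := borelHeight_weylLongU_heisChart_dilate_three hc hcδ hδ t Λ₂ hΛ₂ X' s 1
      rw [hlam, mul_one, mul_one, hd0] at h
      rw [h, NNReal.coe_mul, NNReal.coe_inv, Real.mul_rpow (inv_nonneg.2 (NNReal.coe_nonneg _)) (NNReal.coe_nonneg _),
        ENNReal.ofReal_mul (Real.rpow_nonneg (inv_nonneg.2 (NNReal.coe_nonneg _)) _)]
    simp_rw [hdil]
    rw [lintegral_const_mul' _ _ ENNReal.ofReal_ne_top]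
    congr 1
    -- (b) the Heisenberg shift `u(x₀ − Y, θ s) = u(x₀, θ(s − β))·u(−Y, θ 0)` and translation invariance
    set β : AdeleRing (𝓞 F) F := (traceZeroLine F E c hcδ hδ).symm (coordY hc (heisChart hc (algebraMap E (AdeleRing (𝓞 E) E) x₀, (0 : traceZeroAdele F E c)) *
      heisChart hc (-Y, (0 : traceZeroAdele F E c)))) with hβ
    have hshift : ∀ a : AdeleRing (𝓞 F) F, ((heisChart hc (X', traceZeroLine F E c hcδ hδ (a + (0 + β))) : ↥(adelicUnipotent F E c 3)) : (quasiSplit F E c 3).Adelic) =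
        ((heisChart hc (algebraMap E (AdeleRing (𝓞 E) E) x₀, traceZeroLine F E c hcδ hδ a) : ↥(adelicUnipotent F E c 3)) : (quasiSplit F E c 3).Adelic) *
          ((heisChart hc (-Y, traceZeroLine F E c hcδ hδ 0) : ↥(adelicUnipotent F E c 3)) : (quasiSplit F E c 3).Adelic) := by
      intro a
      rw [← Subgroup.coe_mul, heisChart_traceZeroLine_mul hc hcδ hδ, hX', sub_eq_add_neg, ← add_assoc]
    rw [← lintegral_add_right_eq_self (μ := μF) (fun s => ENNReal.ofReal (((borelHeight (W * ((heisChart hc (X', traceZeroLine F E c hcδ hδ s) : ↥(adelicUnipotent F E c 3)) :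
          (quasiSplit F E c 3).Adelic) * T) : ℝ)) ^ σ)) (0 + β)]
    simp_rw [hshift]
    -- (c) unfold `𝔸_F = ⨆_ξ (ξ + D_F)` and split `u(x₀, θ(ξ + a)) = u(x₀, θ ξ)·u(0, θ a)`
    rw [h𝓓.lintegral_eq_tsum'' (fun a => ENNReal.ofReal (((borelHeight (W * (((heisChart hc (algebraMap E (AdeleRing (𝓞 E) E) x₀, traceZeroLine F E c hcδ hδ a) :
        ↥(adelicUnipotent F E c 3)) : (quasiSplit F E c 3).Adelic) * ((heisChart hc (-Y, traceZeroLine F E c hcδ hδ 0) : ↥(adelicUnipotent F E c 3)) : (quasiSplit F E c 3).Adelic)) * T) :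
          ℝ)) ^ σ)), ← (principalSubgroupEquiv F).tsum_eq]
    refine tsum_congr fun ξ => lintegral_congr fun a => ?_
    have hv : (((principalSubgroupEquiv F ξ : AdeleRing.principalSubgroup (𝓞 F) F)) +ᵥ a : AdeleRing (𝓞 F) F) = algebraMap F (AdeleRing (𝓞 F) F) ξ + a := rfl
    simp only [hG, hy]
    rw [hv, map_add, ← heisChart_mul_zero hc, Subgroup.coe_mul]
    simp only [mul_assoc]
  -- (d)+(e)+(f) assemble in `ℝ≥0∞`
  have hmain : ∑' x₀ : E, ∫⁻ s, ENNReal.ofReal (((borelHeight (W * ((heisChart hc ((l₁ : AdeleRing (𝓞 E) E) * (algebraMap E (AdeleRing (𝓞 E) E) x₀ - Y), traceZeroLine F E c hcδ hδ s) :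
      ↥(adelicUnipotent F E c 3)) : (quasiSplit F E c 3).Adelic)) : ℝ)) ^ σ) ∂μF ≤
        ENNReal.ofReal ((μF (adeleFundamentalDomain F)).toReal * A₁ * (((L : ℝ))⁻¹) ^ (2 * σ' - 1)) := by
    simp_rw [hper]
    rw [ENNReal.tsum_mul_left, ENNReal.tsum_mul_left, ← ENNReal.tsum_prod, ← lintegral_tsum fun p => (hGm p).aemeasurable]
    calc (L : ℝ≥0∞) * (ENNReal.ofReal (((L : ℝ)⁻¹) ^ σ) * ∫⁻ a in adeleFundamentalDomain F, ∑' p : E × F, G σ p a ∂μF)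
        ≤ (L : ℝ≥0∞) * (ENNReal.ofReal (((L : ℝ)⁻¹) ^ σ) * ∫⁻ _ in adeleFundamentalDomain F, ENNReal.ofReal ((L : ℝ) ^ (σ - σ')) * ENNReal.ofReal (A₁ * ((L : ℝ)⁻¹) ^ σ') ∂μF) := by
          exact mul_le_mul_of_nonneg_left (mul_le_mul_of_nonneg_left (lintegral_mono fun a => hdom a) zero_le) zero_le
      _ = ENNReal.ofReal (L : ℝ) * ENNReal.ofReal (((L : ℝ)⁻¹) ^ σ) * (ENNReal.ofReal ((L : ℝ) ^ (σ - σ')) * ENNReal.ofReal (A₁ * ((L : ℝ)⁻¹) ^ σ')) * μF (adeleFundamentalDomain F) := by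
          rw [setLIntegral_const, ENNReal.ofReal_coe_nnreal]; ring
      _ = ENNReal.ofReal ((μF (adeleFundamentalDomain F)).toReal * A₁ * (((L : ℝ))⁻¹) ^ (2 * σ' - 1)) := by
          conv_lhs => rw [← ENNReal.ofReal_toReal (measure_adeleFundamentalDomain_lt_top F μF).ne, ← ENNReal.ofReal_mul (NNReal.coe_nonneg _),
            ← ENNReal.ofReal_mul (Real.rpow_nonneg hLpos.le _), ← ENNReal.ofReal_mul (mul_nonneg (NNReal.coe_nonneg _) (Real.rpow_nonneg (inv_nonneg.2 hLpos.le) _)),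
            ← ENNReal.ofReal_mul (mul_nonneg (mul_nonneg (NNReal.coe_nonneg _) (Real.rpow_nonneg (inv_nonneg.2 hLpos.le) _))
              (mul_nonneg (Real.rpow_nonneg hLpos.le _) (mul_nonneg hA₁ (Real.rpow_nonneg (inv_nonneg.2 hLpos.le) _))))]
          congr 1
          rw [← mul_inv_rpow_mul_rpow_sub_mul_inv_rpow hLpos σ σ']
          ring
  -- (g) back to `ℝ`: every term is finite, the integrals are Bochner integrals of non-negative continuous functions
  have hB0 : 0 ≤ (μF (adeleFundamentalDomain F)).toReal * A₁ * (((L : ℝ))⁻¹) ^ (2 * σ' - 1) :=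
    mul_nonneg (mul_nonneg ENNReal.toReal_nonneg hA₁) (Real.rpow_nonneg (inv_nonneg.2 hLpos.le) _)
  have hne : ∑' x₀ : E, ∫⁻ s, ENNReal.ofReal (((borelHeight (W * ((heisChart hc ((l₁ : AdeleRing (𝓞 E) E) * (algebraMap E (AdeleRing (𝓞 E) E) x₀ - Y), traceZeroLine F E c hcδ hδ s) :
      ↥(adelicUnipotent F E c 3)) : (quasiSplit F E c 3).Adelic)) : ℝ)) ^ σ) ∂μF ≠ ∞ := ne_top_of_le_ne_top ENNReal.ofReal_ne_top hmain
  have hax : ∀ x₀ : E, ∫⁻ s, ENNReal.ofReal (((borelHeight (W * ((heisChart hc ((l₁ : AdeleRing (𝓞 E) E) * (algebraMap E (AdeleRing (𝓞 E) E) x₀ - Y), traceZeroLine F E c hcδ hδ s) :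
      ↥(adelicUnipotent F E c 3)) : (quasiSplit F E c 3).Adelic)) : ℝ)) ^ σ) ∂μF ≠ ∞ := fun x₀ => ne_top_of_le_ne_top hne (ENNReal.le_tsum x₀)
  have hint : ∀ x₀ : E, ∫ t, ((borelHeight (W * ((heisChart hc ((l₁ : AdeleRing (𝓞 E) E) * (algebraMap E (AdeleRing (𝓞 E) E) x₀ - Y), traceZeroLine F E c hcδ hδ t) :
      ↥(adelicUnipotent F E c 3)) : (quasiSplit F E c 3).Adelic)) : ℝ)) ^ σ ∂μF =
      (∫⁻ s, ENNReal.ofReal (((borelHeight (W * ((heisChart hc ((l₁ : AdeleRing (𝓞 E) E) * (algebraMap E (AdeleRing (𝓞 E) E) x₀ - Y), traceZeroLine F E c hcδ hδ s) :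
        ↥(adelicUnipotent F E c 3)) : (quasiSplit F E c 3).Adelic)) : ℝ)) ^ σ) ∂μF).toReal := fun x₀ =>
    integral_eq_lintegral_of_nonneg_ae (ae_of_all _ fun t => Real.rpow_nonneg (NNReal.coe_nonneg _) σ)
      (continuous_centreLine_borelHeight_rpow_three' hc hcδ hδ hσ0 _).aestronglyMeasurable
  have hfun : (fun x₀ : E => ∫ t, ((borelHeight (W * ((heisChart hc ((l₁ : AdeleRing (𝓞 E) E) * (algebraMap E (AdeleRing (𝓞 E) E) x₀ - Y), traceZeroLine F E c hcδ hδ t) :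
      ↥(adelicUnipotent F E c 3)) : (quasiSplit F E c 3).Adelic)) : ℝ)) ^ σ ∂μF) =
      fun x₀ : E => (∫⁻ s, ENNReal.ofReal (((borelHeight (W * ((heisChart hc ((l₁ : AdeleRing (𝓞 E) E) * (algebraMap E (AdeleRing (𝓞 E) E) x₀ - Y), traceZeroLine F E c hcδ hδ s) :
        ↥(adelicUnipotent F E c 3)) : (quasiSplit F E c 3).Adelic)) : ℝ)) ^ σ) ∂μF).toReal := funext hint
  rw [hfun]
  refine ⟨ENNReal.summable_toReal hne, ?_⟩
  rw [← ENNReal.tsum_toReal_eq hax]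
  exact ENNReal.toReal_le_of_le_ofReal hB0 hmain

/-- **THE DEALT EXPONENT `θ = σ` IN THE RANGE `σ > 3`** (choice `σ′ := (σ + 1)∕2 ∈ (2, σ]` in `exists_forall_tsum_lineMass_dilate_sub_le_three`; no free `σ′` in the signature):
`Σ'_{x₀ ∈ E} N(l₁·((x₀)_𝔸 − Y)) ≤ B · (‖l₂‖⁻¹)^σ`. [cite: MoeglinWaldspurger1995, II.1.7] [cite: Garrett2018, §2.8–§2.9] -/
theorem exists_forall_tsum_lineMass_dilate_sub_le_three_of_three_lt (hc : c * c = 1) (hc1 : c ≠ 1) (hcδ : c δ = -δ) (hδ : δ ≠ 0)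
    (hIw : ∀ g : (quasiSplit F E c 3).Adelic, ∃ b ∈ borelAdelic F E c 3, ∃ k : (quasiSplit F E c 3).Adelic,
      adelicVal F E c 3 ((StdForm.antidiagonal 3).over E) k ∈ standardMaximalCompactGL 3 E ∧ g = b * k)
    [MeasurableSpace (AdeleRing (𝓞 F) F)] [BorelSpace (AdeleRing (𝓞 F) F)] (μF : Measure (AdeleRing (𝓞 F) F)) [μF.IsAddHaarMeasure]
    {σ : ℝ} (hσ : 3 < σ) :
    ∃ B : ℝ, 0 ≤ B ∧ ∀ (l₁ : (AdeleRing (𝓞 E) E)ˣ) (l₂ : (AdeleRing (𝓞 F) F)ˣ) (Y : AdeleRing (𝓞 E) E),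
      ((IdeleClassGroup.ideleNorm F l₂ : ℝ≥0) : ℝ) ≤ 1 →
      ((IdeleClassGroup.ideleNorm E l₁ : ℝ≥0) : ℝ) = ((IdeleClassGroup.ideleNorm F l₂ : ℝ≥0) : ℝ) →
      Summable (fun x₀ : E => ∫ t, ((borelHeight ((quasiSplit F E c 3).toAdelic (weylLongU (c : E →+* E) (rfl : ((StdForm.antidiagonal 3).over E) = ((StdForm.antidiagonal 3).over E))) *
          ((heisChart hc ((l₁ : AdeleRing (𝓞 E) E) * (algebraMap E (AdeleRing (𝓞 E) E) x₀ - Y), traceZeroLine F E c hcδ hδ t) : ↥(adelicUnipotent F E c 3)) :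
            (quasiSplit F E c 3).Adelic)) : ℝ)) ^ σ ∂μF) ∧
      ∑' x₀ : E, ∫ t, ((borelHeight ((quasiSplit F E c 3).toAdelic (weylLongU (c : E →+* E) (rfl : ((StdForm.antidiagonal 3).over E) = ((StdForm.antidiagonal 3).over E))) *
          ((heisChart hc ((l₁ : AdeleRing (𝓞 E) E) * (algebraMap E (AdeleRing (𝓞 E) E) x₀ - Y), traceZeroLine F E c hcδ hδ t) : ↥(adelicUnipotent F E c 3)) :
            (quasiSplit F E c 3).Adelic)) : ℝ)) ^ σ ∂μF ≤
        B * (((IdeleClassGroup.ideleNorm F l₂ : ℝ≥0) : ℝ)⁻¹) ^ σ := by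
  obtain ⟨B, hB, h⟩ := exists_forall_tsum_lineMass_dilate_sub_le_three hc hc1 hcδ hδ hIw μF (σ := σ) (σ' := (σ + 1) / 2) (by linarith) (by linarith)
  refine ⟨B, hB, fun l₁ l₂ Y hl₂ hl₁₂ => ?_⟩
  have h' := h l₁ l₂ Y hl₂ hl₁₂
  rwa [show 2 * ((σ + 1) / 2) - 1 = σ by ring] at h'

end Heisenberg

end Summit.HodgeConjecture.HodgeConjecture.Cruxes.H413.K2E1CentreLineShellSumU3

end
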